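import Mathlib
import HarnessLib
import HarnessLib.Audit
import Summits.PneNP.Statement
import Literature.Computability.MetaComplexity.Frege
import Literature.Computability.Complexity.Classes
import Literature.Computability.Complexity.CNF
import HarnessLib.Audit.Status.Attr

/-!
Route: EfNotPOptimal

# Route EfNotPOptimal — EF is not p-optimal (easy hard sequence) + collapse reaches EF ⇒ P ≠ NP

It suffices to show X = X1 ∧ X2 where X1 = CollapseReachesEF (the shared hub item stmt-PneNP-17354
of FeasibleWitnessing /
FreeHardnessEF: if P = NP then some Frege system F has polynomially bounded EXTENDED Frege proofs)
and X2 = EFNotPOptimal, the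
INSTANCE form of Krajíček–Pudlák's 1989 conjecture "EF is not p-optimal": for every Frege system F
there is an EASY set H of
tautologies (H ∈ P, Sadowski's "easy subsets of TAUT") such that no polynomial-time function outputs
EF_F-proofs of all members of H.
Glue S1 = EFProofSearchOfCollapse (provable now: under P = NP a p-bounded EF has polynomial-time
proof SEARCH, by search-to-decision).
¬S ⇒ (X1) EF_F p-bounded ⇒ (S1) a p-time f proves every tautology ⇒ f proves H, contradicting X2.
Realises sketch ef-not-p-optimal.
X2 is the attacked conjunct; X1 is declared residual (shared, staffed on its own registered line).
Lean: `CollapseReachesEF ∧ EFNotPOptimal`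

## Assembly
Pure logic (glue.lean `closes`, certified): assume ¬ PneNP; X1 gives F with IsFrege F and EF_F
p-bounded; S1 gives a polynomial-time f
with F.IsEFProofOf (f φ) φ for every tautology φ; X2 applied to F gives H ⊆ TAUT with no such f on H
— contradiction (H ∈ P is not
consumed by `closes`; it is what makes X2 the printed conjecture rather than a restatement, see
Novelty). No further assembly item is
filed beyond the mandatory composition statement below (exempt from the cone count).

Rationale: WHY THIS LINE. Every proof-complexity route on the hub buys P ≠ NP with a LENGTH-of-proofs lower
bound (EFLowerBound in FeasibleWitnessing,
NoPolyBoundedProofSystem ↔ NP ≠ coNP in ProofCplx, barrier entry C1) or with the class-wide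
NoPOptimalTaut (Descriptive: no p-optimal
proof system at all, which implies E ≠ NE by KrajicekPudlak1989 and decides S alone). This line
replaces the size coordinate by the
UNIFORMITY coordinate of one fixed strong system: non-p-optimality of EF says nothing about proof
size (EF may be p-bounded) and is a
printed open problem one quantifier below NoPOptimalTaut (Krajicek2019 Problem 1.5.5, §21.6;
KoblerMessnerToran2003; Sadowski 2002
Thm 6.6, paper:galaxy-pdf-6661757623842430400). Imported: structural complexity of optimal proof
systems / optimal acceptors
(diagonalization over proof systems, KMT03, ChenFlum2010, Messner) and the Krajíček–Pudlák
reflection dictionary (Krajicek1995 Thm 14.1.2)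
which turns "W is not p-simulated by EF" into an explicit easy hard sequence ‖Ref_W‖ⁿ; the price of
dropping "size" is paid by X1.

RANKED CRUXES. #2 EFNotPOptimal (crux) — (sketch item X2, Krajíček–Pudlák "EF is not p-optimal",
instance / easy-hard-sequence form) for every Frege system F (finite sound implicationally complete
rule list) there is a set H of tautologies, decidable in polynomial time, such that no
polynomial-time computable f maps every φ ∈ H to an extended-Frege (EF_F) proof of φ. [difficulty:
open-problem] (why it might fail: EF could simply be p-optimal — open since 1989 and refuted under
no standard hypothesis (collapses such as E = NE even make SOME system p-optimal, Krajicek2019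
§21.6); and the instance form needs the hard family EASY (H ∈ P), cf. Sadowski 2002 Thm 6.6 on easy
subsets of TAUT.) [KrajicekPudlak1989, Krajicek2019, Krajicek1995, KoblerMessnerToran2003,
paper:galaxy-pdf-6661757623842430400, ChenFlum2010]
#3 CollapseReachesEF (crux) — (sketch item X1 = shared hub item stmt-PneNP-17354, FeasibleWitnessing
/ FreeHardnessEF) if P = NP (¬ PneNP) then some Frege system F has polynomially bounded extended
Frege proofs: every tautology φ has an EF_F-proof of size polynomial in the size of φ. [difficulty:
XL] (why it might fail: P = NP yields poly-size SAT circuits, but EF-provable CORRECTNESS of some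
such circuit family is exactly what is open (Cook 1975 / Krajicek2019 §21.3); the collapse may reach
only EF + extra axioms ‖φ_n‖, not EF itself.) [Krajicek2019, CookReckhow1979, KrajicekPudlak1989]
#9 EFProofSearchOfCollapse (support) — (sketch glue S1, provable now) if P = NP then for every Frege
system F whose extended Frege system is polynomially bounded there is a polynomial-time computable f
mapping every tautology φ to an EF_F-proof of φ (search-to-decision for the NP relation "π is an
EF_F-proof of φ of size ≤ p(|φ|)", after polynomial renaming of extension variables; needs a
polynomial-time EF_F-proof checker, the EF analogue of exists_isProofSystemFor_of_isFrege_holds).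
[difficulty: provable-now] [CookReckhow1979, Krajicek2019]

TWO-LAYER PLAN. EFNotPOptimal ⇐ ReflectionDictionary → EFNotPOptimalSys → EFNotPOptimal (the
registered birth skeleton Cruxes/EFNotPOptimal/Lines/birth.lean):
ReflectionDictionary = the uniform Krajíček–Pudlák dictionary (for every proof system W for TAUT an
easy H_W ⊆ TAUT such that p-time
EF_F-proofs of H_W give EF_F ≥ₚ W; printed, Krajicek1995 Thm 14.1.2 / Krajicek2019 Lemma 19.2.2,
L–XL to formalise via CookTranslation),
EFNotPOptimalSys = ∃ W a proof system for TAUT not p-simulated by EF_F (the open system form;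
exposes W to diagonalization / optimal
acceptors, Krajicek2019 Lemma 21.1.4, Messner, ChenFlum2010). CollapseReachesEF keeps its registered
3-stub line (SAT circuits with
EF-provable correctness). Nothing here is filed now.

KILL CRITERIA. A theorem `¬ EFNotPOptimal` (some Frege F for which every easy H ⊆ TAUT has p-time
constructible EF_F-proofs, i.e. EF_F p-optimal by
KoblerMessnerToran2003 / Sadowski Thm 6.6) closes the route `refuted:EFNotPOptimal` — and would
itself be a major theorem. A refutation of
CollapseReachesEF breaks this route together with FeasibleWitnessing / FreeHardnessEF (shared item):
pivot X1 to "collapse reaches EF + ‖φ_n‖"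
and X2 to non-p-optimality of that extension. If NoPOptimalTaut (stmt-PneNP-8869, Descriptive) is
PROVED, X2 follows (KMT03 construction)
and S already follows from Descriptive.closes — this route is then mooted (`superseded --by
route-PneNP-Descriptive`).

NOT DECOMPOSED YET. The system form / instance form equivalence for EF (both directions printed:
KMT03 §2–3 construction g_M; Krajíček–Pudlák reflection) is
kept inside the birth skeleton, not filed as items; the Δᵇ₁-definition of W-provability and the
uniform EF-proofs of the Cook translation
(CookCorrespondence) are prover-level lemmas under ReflectionDictionary; the EF proof-checker
machine and the renaming lemma live under S1.
No regime split of X2 by proof system strength is filed (the AC⁰_d-Frege regime is a theorem: BC5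
rung).

CHEAPEST FALSIFIER. Lookup, run: is "EF is p-optimal" known under any hypothesis the hub registers
(Literature/StrongHypotheses/PneNP.lean: NPNeCoNP,
TautHasNoPolyBoundedProofSystem, EXPNeNEXP, KrajicekGeneratorConjecture, …)? None implies or refutes
X2 (checked by reading; the tree's only
p-optimality facts are KrajicekPudlak1989_pOptimalTaut_of_E_eq_NE_holds — existence of SOME
p-optimal system under E = NE, not EF — and
Messner's coNE theorem). In-Lean: BC2/BC7 probes `EFNotPOptimal → PneNP` / `PneNP → EFNotPOptimal`
both FAIL (rc 1, aesop exhaustive).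
The cheapest mathematical kill would be a proof that EF p-simulates EF + Ref_W for every W
(Krajicek2019 Lemma 19.2.3 gives only W = EF).

NUMBERS. BC5 rung (landed, sorry-free, bc/EFNotPOptimal_rung.lean → Cruxes/EFNotPOptimal/Lines/):
for every depth d no polynomial-time machine
1ⁿ ↦ π_n outputs depth-d textbookFrege proofs of PHP^{n+1}_n (output length ≤ n + D·p(n) versus
Ajtai's 2^{n^{ε_d}},
boundedDepthFrege_pigeonhole_lowerBound_holds), while PHP^{n+1}_n has Frege proofs of size
2^{2(⌊log₂ n⌋+7)²} (tree, weak Buss1987):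
fixed-system non-p-optimality with an explicit easy hard sequence is DECIDED for AC⁰_d-Frege, every
d (Ajtai1988, KrajicekPudlakWoods1995),
open from Frege / EF on. Honest regime reading (tribunal kernel, FILE-mode full run): witness
present and axiom-clean, but the S-restricted case of
that regime (Ajtai's bound, `boundedDepthFrege_pigeonhole_lowerBound_holds`; circuit side PARITY ∉
AC⁰ via `Locality_parityLocalizes_holds`) is a
tree theorem, so the rung sits INSIDE the Cook–Reckhow shadow of S's known regime (chip
`T3-inside-known-regime`); no rung of EF-non-p-optimality
outside that shadow is known in print (fixed-k diagonalization needs superlinear EF bounds;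
Messner's coNE sets without optimal systems lie outside P by
hierarchy). Refutable instances: for a FIXED easy H the inner claim is refutable by exhibiting a
generator — H = PHP is so refuted (CookReckhow1979:
p-time constructible polynomial EF-proofs of PHP), which is why the crux quantifies ∃H.

DEFINITION REQUESTS. None needed to state the items (FregeSystem, IsFrege, IsEFProofOf,
IsEFPolyBounded, PolyTimeComputable, encodingPropForm, Classes.P,
IsTautology all exist). Wanted later by provers, not filed now: a named `PSimulatesEF F W` /
`IsEFPOptimal F` (MetaComplexity/ProofSystems)
for the system form, and the EF proof-checker machine (EF analogue of
FregeProofSystem.exists_isProofSystemFor_of_isFrege_holds) for S1.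

Novelty: Searches (2026-08-17): lit search --hybrid "p-optimal proof system easy subsets TAUT polynomial time
constructible proofs" (10 docs: Krajicek1995 pp.252–259, krajind pp.44/450–452/462,
GlasserSelmanZhang2006 pp.268–279, Krajíček 2010 Forcing pp.163–172); lit search "Köbler Messner
Torán optimal proof systems …" (8 local: KMT03 held, arXiv:2602.02294, arXiv:2408.07408,
arXiv:2304.14702, ChenFlum2010); lit galaxy search "p-optimal proof system|optimal proof
systems|p-optimal" --star all (25 rows, 1 relevant: pdf:2039045080 Beyersdorff–Sadowski); lit galaxy
search "optimal propositional proof system|…" --star all (18 rows: panama:423947631853605 Krajíček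
Forcing, panama:332267259953240 Krajicek1995, pdf:6661757623842430400 Sadowski 2002,
pdf:6201852720248499580 Chen–Flum, pdf:-3403894880986810980 Dagstuhl 14421, pdf:5032926836655846840
GSZ survey); ledger negatives --problem PneNP (6, none on proof systems); lean search / BC4 exact?
over 29 Literature modules + 10 Theses (no hit); hub routes read: FeasibleWitnessing, Descriptive
(NoPOptimalTaut strategist census names "Inst EF" as the honest S-free weakening), ProofCplx.
Nearest prior art found: KrajicekPudlak1989 / Krajicek2019 Problem 1.5.5 + §21.6
[corpus:book:krajind-proof-complexity p.44, p.462] (the conjecture and the reflection dictionary);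
Sadowski 2002 Def 6.1 / Thm 6.6 [galaxy:pdf:6661757623842430400 p.6, p.9] and KoblerMessnerToran2003
§2–3 [corpus:paper:doi-10-1016-s0890-5401-03-00058-0 p.6, Thm 6.3 p.19] (easy subse  [refs: 2602.02294, 2408.07408, 2304.14702, book:krajind-proof-complexity, paper:doi-10-1016-s0890-5401-03-00058-0, Krajicek1995, GlasserSelmanZhang2006, ChenFlum2010, KrajicekPudlak1989, Krajicek2019, KoblerMessnerToran2003]

Barriers (technique_class: proof-complexity, diagonalization, reflection-principles): - technique_class: proof-complexity, diagonalization, reflection-principles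
- Literature.Barriers.PneNP.Relativization: X2 as typed quantifies over no oracle and does not imply
S (BC2 probe fails; under E = NE a p-optimal system exists, tree fact
KrajicekPudlak1989_pOptimalTaut_of_E_eq_NE_holds, and X2 can still hold), so A1
(`Relativization.of_bgs`) bites the CONJUNCTION only through X1, whose registered line uses
EF-provable correctness of SAT circuits = local checkability, the non-relativizing axiom the
catalogue's A1 entry names; diagonalization over proof systems does relativize and oracles exist
both ways for optimal proof systems [corpus:book:editornd-theoretical-computer-science p.269] — the
bet is that the non-relativizing content sits in X1 and in the concrete system EF, cf. Monroe's
question [galaxy:pdf:-3403894880986810980 p.15].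
- Literature.Barriers.PneNP.RelativizationNarrow: A2's dense/thin-oracle reading (file
RelativizationSparse.lean) targets proofs of P ≠ NP robust under sparse oracles (= NP ⊄ P/poly);
this route claims no circuit lower bound — X1 even USES NP ⊆ P/poly-type circuits under the
collapse; outside.
- Literature.Barriers.PneNP.RelativizedCircuitSize: A5 (Wilson) blocks relativizing proofs of
CIRCUIT-SIZE lower bounds; no item of this route is a circuit lower bound (X1 assumes polynomial
circuits for SAT under the collapse, X2 is a uniform proof-search impossibility for EF, S1 a
simulation) — outside its quantifier; the diagonalization/simulatio

sub-problem: PneNP · status: open · opened planner-type-2f4be96892-0 2026-08-17T18:05:11Z · rev 1 · ledger route-PneNP-EfNotPOptimal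
GENERATED by the gate from the ledger (D-0016/17). Provers cite these decls: `theorem foo : Summit.PneNP.PneNP.Theses.EfNotPOptimal.<Decl> := …` in Summits/PneNP/PneNP/Theorems/<Name>.lean.
-/

namespace Summit.PneNP.PneNP.Theses.EfNotPOptimal

open scoped BigOperators Topology Manifold Classical MeasureTheory ProbabilityTheory Matrix InnerProductSpace ComplexConjugate ContinuousMap
open Filter Set Function TopologicalSpace MeasureTheory

attribute [summit_statement] _root_.PneNP

open Literature.PNP

/-- item stmt-PneNP-18942 · crux · rank 2 · open · by planner
why it might fail: EF could simply be p-optimal: open since 1989, refuted under no standard hypothesis (E = NE even yields SOME p-optimal system, Krajicek2019 §21.6); the instance form needs the hard family EASY (H ∈ P) — for a fixed easy H such as PHP it is false (p-time EF-proofs, CookReckhow1979).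
sources: KrajicekPudlak1989, Krajicek2019, Krajicek1995, KoblerMessnerToran2003, Sadowski2002, ChenFlum2010
[crux] (sketch item X2, Krajíček–Pudlák "EF is not p-optimal", instance / easy-hard-sequence form)
for every Frege system F (finite sound implicationally complete rule list) there is a set H of
tautologies, decidable in polynomial time, such that no polynomial-time computable f maps every φ ∈
H to an extended-Frege (EF_F) proof of φ. [difficulty: open-problem] -/
@[route_item "route-PneNP-EfNotPOptimal", crux]
def EFNotPOptimal : Prop :=
  ∀ F : Literature.Computability.MetaComplexity.FregeSystem, Literature.Computability.MetaComplexity.IsFrege F → ∃ H : Set (Literature.Computability.Complexity.PropForm ℕ), (∀ φ ∈ H, φ.IsTautology) ∧ Literature.Computability.Complexity.encodingPropForm.toLanguage H ∈ Literature.Computability.Complexity.Classes.P ∧ ¬ ∃ f : Literature.Computability.Complexity.PropForm ℕ → List (Literature.Computability.Complexity.PropForm ℕ), Literature.Computability.Complexity.PolyTimeComputable Literature.Computability.Complexity.encodingPropForm.encode Literature.Computability.Complexity.encodingPropForm.listBool.encode f ∧ ∀ φ ∈ H, F.IsEFProofOf (f φ) φ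

/-- item stmt-PneNP-17354 · crux · rank 3 · open · by planner
why it might fail: P = NP yields poly-size SAT circuits, but EF-provable CORRECTNESS of some such circuit family is exactly what is open (Cook 1975 / Krajicek2019 §21.3); the collapse may reach only EF + extra axioms ‖φ_n‖, not EF itself.
sources: Krajicek2019, CookReckhow1979, KrajicekPudlak1989
[crux] if P = NP (¬PneNP) then some — equivalently every — Frege system has polynomially bounded
extended Frege proofs: "any superpolynomial EF lower bound separates P and NP" (Pich–Santhanam Open
Problem 1), to be obtained from S¹₂-provable uniform witnessing of errors of n^k-time SAT algorithms
(Cor. 20(2)) or APC₁-provable anticheckers (§1.3.1; KPS26 Condition 2). [difficulty: open-problem] -/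
@[route_item "route-PneNP-EfNotPOptimal", crux]
def CollapseReachesEF : Prop :=
  ¬ PneNP → ∃ F : Literature.Computability.MetaComplexity.FregeSystem, Literature.Computability.MetaComplexity.IsFrege F ∧ F.IsEFPolyBounded

/-- item stmt-PneNP-18943 · support · rank 9 · closed · proved by Summit.PneNP.PneNP.Theorems.EFProofSearch.efProofSearchOfCollapse (prover) · by planner
sources: CookReckhow1979, Krajicek2019, AroraBarak2009
[support] (sketch glue S1, provable now) if P = NP then for every Frege system F whose extended
Frege system is polynomially bounded there is a polynomial-time computable f mapping every tautology
φ to an EF_F-proof of φ (search-to-decision for the NP relation "π is an EF_F-proof of φ of size ≤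
p(|φ|)", after polynomial renaming of extension variables; needs a polynomial-time EF_F-proof
checker, the EF analogue of exists_isProofSystemFor_of_isFrege_holds). [difficulty: provable-now] -/
@[route_item "route-PneNP-EfNotPOptimal", crux]
def EFProofSearchOfCollapse : Prop :=
  ¬ PneNP → ∀ F : Literature.Computability.MetaComplexity.FregeSystem, Literature.Computability.MetaComplexity.IsFrege F → F.IsEFPolyBounded → ∃ f : Literature.Computability.Complexity.PropForm ℕ → List (Literature.Computability.Complexity.PropForm ℕ), Literature.Computability.Complexity.PolyTimeComputable Literature.Computability.Complexity.encodingPropForm.encode Literature.Computability.Complexity.encodingPropForm.listBool.encode f ∧ ∀ φ : Literature.Computability.Complexity.PropForm ℕ, φ.IsTautology → F.IsEFProofOf (f φ) φ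

-- `EFProofSearchOfCollapse` holds: proved by `Summit.PneNP.PneNP.Theorems.EFProofSearch.efProofSearchOfCollapse` (its module imports this route file, so no `_holds` link can be stated here).

/-- item stmt-PneNP-18944 · assembly · rank 1 · open · by planner
sources: KrajicekPudlak1989, Krajicek2019
[assembly] CollapseReachesEF → EFNotPOptimal → EFProofSearchOfCollapse → P ≠ NP (the composition;
the deciding theorem `closes` in glue.lean proves exactly this). -/
@[route_item "route-PneNP-EfNotPOptimal"]
def Assembly : Prop :=
  CollapseReachesEF → EFNotPOptimal → EFProofSearchOfCollapse → PneNP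

/-! D-0027 §2.1 — DECIDING THEOREM (planner-authored via `route open/edit --closes-file`; by planner-type-2f4be96892-0 2026-08-17T18:05:11Z):
its hypotheses are this route's items and its conclusion the sub-problem Statement (glue_lint), and it elaborates with this file. -/

@[closes "route-PneNP-EfNotPOptimal"] theorem closes (hX1 : CollapseReachesEF) (hX2 : EFNotPOptimal) (hS1 : EFProofSearchOfCollapse) : PneNP := by
  by_contra hS
  obtain ⟨F, hF, hb⟩ := hX1 hS
  obtain ⟨f, hf, hall⟩ := hS1 hS F hF hb
  obtain ⟨H, hHT, _hHP, hno⟩ := hX2 F hF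
  exact hno ⟨f, hf, fun φ hφ => hall φ (hHT φ hφ)⟩

end Summit.PneNP.PneNP.Theses.EfNotPOptimal
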